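/-
Copyright: b2b-lace packet (Lean typing seat 1, gen 41).  [FvdH17] §5.1 "Elements of the bounds" / §5.4 / §4.2
(4.20)–(4.21): the ENTRY INEQUALITIES for the elements `(P⃗^E)_0 = Σ_x P̃(0 ⇔ x)` and `(A)_{0,0} = Σ_{x≠0} P̃(0 ⇔ x)`
in terms of the Bubble cell,
over the tree objects `vecPE` (`NobleBlocks`), `Letters.perc` (`NoblePercLetters`), `diagD` (`NobleBoundsN0`) and the
landed cell `sumLE_diagD_halfBubble_printed` (`DoubleConnectionBubbleCell`).  Proofs only; no named fact; no numeral;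
no dimension.
-/
import Literature.Probability.FitznerVanDerHofstad2017.NobleElementsClosedForms
import Literature.Probability.FitznerVanDerHofstad2017.NoblePercLetters
import Literature.Probability.FitznerVanDerHofstad2017.DoubleConnectionBubbleCell
import HarnessLib

/-!
# [FvdH17] §5.1 / §5.4: the entries `(P⃗^E)_0 = (P⃗^S)_0 = Σ_x P̃(0 ⇔ x) ≤ 1 + ½·Bound[Bubble, 2, M]` and
`(A)_{0,0} = Σ_{x ≠ 0} P̃(0 ⇔ x) ≤ ½·Bound[Bubble, 2, M]`

CITATION HEADER (PLACEMENT v2). This module is part of a certified REPRODUCTION of: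
R. Fitzner, R. van der Hofstad, *Mean-field behavior for nearest-neighbor percolation in `d > 10`*,
Electron. J. Probab. **22** (2017) no. 43 [FvdH17] (extended version arXiv:1506.07977v2), §5.1 "Elements of the
bounds" (arXiv v2 p. 49: `(P⃗^S)_b = Σ_{x,y} P^{S,b}(x,y)`, `(P⃗^E)_b = Σ_{x,y} P^{E,b}(x,y)`), App. B Table
"definition of `P^b(x,y)`" row `b = 0` (p. 73: `δ_{0,x} + (1−δ_{0,x}) P(0 ⇔ x)`) and Table "definition of
`A^{a,b}(0,v,x,y)`" row `a = b = 0` (p. 74: `(1−δ_{0,x}) P(0 ⇔ x)`), §5.4 "Summary of the bounds"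
(closing paragraph, p. 56; EJP p. 52: "Using that `p = p_I` … or that the bootstrap functions are bounded, we can compute numerical
bounds on these diagrammatic bounds, see (4.21) for the idea of these bounds, or [NoBLE, Section 5] for a complete
description"), and §4.2 (4.20)–(4.21) (pp. 36–37: `P_p(0 ⇔ x) ≤ ½ Σ …` for `x ≠ 0`, the Bubble bound); and of
R. Fitzner, R. van der Hofstad, *Generalized approach to the non-backtracking lace expansion*, Probab. Theory Related
Fields **169** (2017) 1041–1119 [NoBLE17], §5.3 (SRW-integral form of the tails).  Origin: build `lace` (host summit
CriticalPhenomena), Lean typing seat; node N76-E(a) of the cell's lemma DAG (the plain `N = 1` entry inequalities),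
entry `(V).0` (and the element `(A)_{0,0}`, the scalar of the `N ≥ 2` payload term).

WHAT THIS FILE DOES.  The closed form `vecPE_zero_eq : vecPE L 0 = Σ_x P̃_L(0 ⇔ x)` (`NobleElementsClosedForms`) is an
identity for every letter table `L`.  At the percolation letters `L = Letters.perc d p` the summand is `1` at `x = 0`
and `P_p(0 ⇔ x) = 𝓓_{1,1}(x)` at `x ≠ 0` (a double connection between distinct sites is the disjoint occurrence of two
open paths of length `≥ 1`: `openConnGe_one_eq`), so the landed Bubble cell
`DoubleConnectionBubbleCell.sumLE_diagD_halfBubble_printed` (`Σ_x 𝓓_{n,n}(x) ≤ ½·Bound[Bubble, 2n, M]` with the printed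
constants `(2d−1)p ≤ Γ₁`, `f₂(p) = nobleF2 d p ≤ Γ₂`; `d ≥ 5`, `p < p_c`, `2n ≤ M`) at `n = 1` gives the ENTRY
INEQUALITY in the shape the block-summation majorant consumes
(`BlockSummationMajorant.tsum_toReal_le_of_xSpaceBound_of_majorants`, hypothesis `hPE : ∀ b, vecP PE b ≤ ENNReal.ofReal (wR b)`):

* `halfBubblePrintedR d p Γ₁ Γ₂ n M` — the right-hand side of the printed Bubble cell as a TOTAL real function
  (finite sum over `L ∈ [2n, M)` of `(L+1−2n)·#{closed L-trails at 0}·p^L`, plus the two SRW-integral tails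
  `(M−2n)·((2d/(2d−1))Γ₁)^M·((2d−2)/(2d−1))Γ₂·K_{1,M}(0)` and `((2d/(2d−1))Γ₁)^M·(((2d−2)/(2d−1))Γ₂)²·K_{2,M}(0)`),
  and `sumLE_diagD_halfBubblePrintedR` = the landed cell restated through it;
* `vecPEZeroR d p Γ₁ Γ₂ M := 1 + halfBubblePrintedR d p Γ₁ Γ₂ 1 M`;
* `perc_pdbc_of_ne_zero : P̃(0 ⇔ x) = 𝓓ᵀ_{1,1}(x)` (`x ≠ 0`), `perc_pdbc_le_kd_add` (pointwise majorant
  `P̃(0 ⇔ x) ≤ δ_{x,0} + ofReal 𝓓_{1,1}(x)`), `tsum_perc_pdbc_le_of_sumLE` (any `SumLE (𝓓_{1,1}) B` gives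
  `Σ_x P̃(0 ⇔ x) ≤ ofReal (1 + B)`);
* `vecPE_zero_le_ofReal` — **the entry inequality** `vecPE (Letters.perc d p) 0 ≤ ENNReal.ofReal (vecPEZeroR d p Γ₁ Γ₂ M)`
  for `5 ≤ d`, `p < p_c`, `(2d−1)p ≤ Γ₁`, `nobleF2 d p ≤ Γ₂`, `2 ≤ M`, with `vecPEZeroR_nonneg` under the same hypotheses
  (the consumer's `hw0`), and the same two facts for `vecPS … 0` (`vecPE_zero : vecPE L 0 = vecPS L 0`).
* §C, the off-origin part: `matA_zero_zero : (A)_{0,0} = Σ_x (1−δ_{x,0}) P̃_L(0 ⇔ x)` (`NobleElementsClosedForms`) at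
  `L = Letters.perc d p` — `kdc_mul_perc_pdbc_le` (pointwise `(1−δ_{x,0}) P̃(0 ⇔ x) ≤ ofReal 𝓓_{1,1}(x)`),
  `perc_matA_zero_zero_le_of_sumLE` (any `SumLE (𝓓_{1,1}) B` gives `(A)_{0,0} ≤ ofReal B`) and
  `perc_matA_zero_zero_le_ofReal : matA (Letters.perc d p) 0 0 ≤ ENNReal.ofReal (halfBubblePrintedR d p Γ₁ Γ₂ 1 M)` —
  the element `(A)_{0,0} ≤ ½·Bound[Bubble, 2, M]` (notebook `Bound[PS,0,s] − 1`), same hypotheses.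

Any `d ≥ 5`; nothing landed is modified; no cited hypothesis — every statement is a kernel-proved inequality between
the landed definitions.  The authors' notebook computes this entry as `Bound[PE,0,s] = Bound[PS,0,s] = 1 + ½·Bound[Bubble,2,s]`
(`Percolation.nb` cell 16, typed as `Stage1Cells.PE P 0 = 1 + bubble P 2 0 /ₙ 2`); the identification of
`halfBubblePrintedR` with that table expression (closed-trail counts `nrBAW[j,d,{0}]`, SRW integrals `I[n,R,{0}]`,
`z[o] = Γ₁/(2d−1)`, `VarGamma2`) and every numerical reading (`d = 11`, `d = 10`) are NOT part of this module.
-/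

noncomputable section

namespace Literature.Probability.FitznerVanDerHofstad2017

open MeasureTheory Finset
open scoped BigOperators ENNReal
open Literature.Probability.LatticeModels Literature.Probability.Percolation
open Literature.Barriers.CriticalPhenomena
open Literature.Probability.FitznerVanDerHofstad2017.NobleBlocks

variable {d : ℕ}

/-! ## A. The printed Bubble cell as a total real function -/

/-- `½·Bound[Bubble, 2n, M]` with the printed constants: the right-hand side of
`DoubleConnectionBubbleCell.sumLE_diagD_halfBubble_printed`, as a total real function of `(d, p, Γ₁, Γ₂, n, M)`.
[cite: FitznerVanDerHofstad2017, §4.2 (4.20)–(4.23) (arXiv:1506.07977v2 pp. 36–37)]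
[cite: FitznerVanDerHofstad2016NoBLE, §5.3.1 and (5.13) (PTRF 169 (2017) pp. 1091, 1096–1097)] -/
def halfBubblePrintedR (d : ℕ) (p Γ₁ Γ₂ : ℝ) (n M : ℕ) : ℝ :=
  1 / 2 * ((∑ L ∈ Finset.Ico (2 * n) M, ((L + 1 - 2 * n : ℕ) : ℝ) * ((trailWordsTo d L 0).card : ℝ) * p ^ L) +
    ((M - 2 * n : ℕ) : ℝ) * ((2 * d / (2 * d - 1) * Γ₁) ^ M * ((2 * d - 2) / (2 * d - 1) * Γ₂ * srwK d 1 M 0)) +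
      (2 * d / (2 * d - 1) * Γ₁) ^ M * (((2 * d - 2) / (2 * d - 1) * Γ₂) ^ 2 * srwK d 2 M 0))

/-- The landed Bubble cell through `halfBubblePrintedR`: `Σ_x 𝓓_{n,n}(x) ≤ ½·Bound[Bubble, 2n, M]`
(`d ≥ 5`, `p < p_c`, `1 ≤ n`, `2n ≤ M`, `(2d−1)p ≤ Γ₁`, `nobleF2 d p ≤ Γ₂`).
[cite: FitznerVanDerHofstad2017, §4.2 (4.20)–(4.23) (arXiv:1506.07977v2 pp. 36–37)] -/
theorem sumLE_diagD_halfBubblePrintedR (hd : 5 ≤ d) (p : unitInterval) (hp : p < criticalProbI d) {n : ℕ}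
    (hn : 1 ≤ n) {M : ℕ} (hM : 2 * n ≤ M) {Γ₁ Γ₂ : ℝ} (hΓ1 : (2 * d - 1) * (p : ℝ) ≤ Γ₁)
    (hΓ2 : nobleF2 d p ≤ Γ₂) :
    SumLE (diagD d p n n) (halfBubblePrintedR d p Γ₁ Γ₂ n M) :=
  sumLE_diagD_halfBubble_printed hd p hp hn hM hΓ1 hΓ2

/-- Under the cell's hypotheses `0 ≤ ½·Bound[Bubble, 2n, M]` (it dominates the non-negative sum `Σ_x 𝓓_{n,n}(x)`).
[cite: FitznerVanDerHofstad2017, §4.2 (4.20)–(4.23) (arXiv:1506.07977v2 pp. 36–37)] -/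
theorem halfBubblePrintedR_nonneg (hd : 5 ≤ d) (p : unitInterval) (hp : p < criticalProbI d) {n : ℕ}
    (hn : 1 ≤ n) {M : ℕ} (hM : 2 * n ≤ M) {Γ₁ Γ₂ : ℝ} (hΓ1 : (2 * d - 1) * (p : ℝ) ≤ Γ₁)
    (hΓ2 : nobleF2 d p ≤ Γ₂) : 0 ≤ halfBubblePrintedR d p Γ₁ Γ₂ n M :=
  (tsum_nonneg fun x => diagD_nonneg p n n x).trans (sumLE_diagD_halfBubblePrintedR hd p hp hn hM hΓ1 hΓ2).2

/-! ## B. The element `(P⃗^E)_0` at the percolation letters -/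

/-- The real majorant of the entry `(P⃗^E)_0 = (P⃗^S)_0`: `1 + ½·Bound[Bubble, 2, M]`.
[cite: FitznerVanDerHofstad2017, §5.1 "Elements of the bounds" and App. B Table "P^b" row b = 0 (arXiv:1506.07977v2 pp. 49, 73); §4.2 (4.20)–(4.21) (pp. 36–37)] -/
def vecPEZeroR (d : ℕ) (p Γ₁ Γ₂ : ℝ) (M : ℕ) : ℝ :=
  1 + halfBubblePrintedR d p Γ₁ Γ₂ 1 M

/-- For `x ≠ 0`, `P̃_p(0 ⇔ x) = P_p(0 ⇔ x) = 𝓓ᵀ_{1,1}(x)`: a double connection between distinct sites is the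
disjoint occurrence of two open paths of length `≥ 1` (`openConnGe_one_eq`).
[cite: FitznerVanDerHofstad2017, §4.2 (4.12) and "Bounds on double connections" (arXiv:1506.07977v2 pp. 35–36)] -/
theorem perc_pdbc_of_ne_zero (p : unitInterval) {x : Site d} (hx : x ≠ 0) :
    (Letters.perc d p).pdbc x = diagDT d p 1 1 x := by
  rw [Letters.pdbc, if_neg hx, perc_dbc, diagDT, openConnGe_one_eq (Ne.symm hx)]

/-- Pointwise majorant `P̃_p(0 ⇔ x) ≤ δ_{x,0} + ofReal 𝓓_{1,1}(x)` (equality in each of the cases `x = 0`, `x ≠ 0`).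
[cite: FitznerVanDerHofstad2017, App. B Table "P^b" row b = 0 (arXiv:1506.07977v2 p. 73); §4.2 (4.12) (p. 35)] -/
theorem perc_pdbc_le_kd_add (p : unitInterval) (x : Site d) :
    (Letters.perc d p).pdbc x ≤ (if x = 0 then (1 : ℝ≥0∞) else 0) + ENNReal.ofReal (diagD d p 1 1 x) := by
  by_cases hx : x = 0
  · subst hx
    rw [Letters.pdbc, if_pos rfl, if_pos rfl]
    exact le_self_add
  · rw [perc_pdbc_of_ne_zero p hx, if_neg hx, zero_add, diagD, ENNReal.ofReal_toReal (diagDT_ne_top p 1 1 x)]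

/-- TRANSFER FORM: any genuine bound `Σ_x 𝓓_{1,1}(x) ≤ B` gives `Σ_x P̃_p(0 ⇔ x) ≤ ofReal (1 + B)`.
[cite: FitznerVanDerHofstad2017, §5.1 "Elements of the bounds" (arXiv:1506.07977v2 p. 49); §4.2 (4.20)–(4.21) (pp. 36–37)] -/
theorem tsum_perc_pdbc_le_of_sumLE (p : unitInterval) {B : ℝ} (hB : SumLE (diagD d p 1 1) B) :
    ∑' x, (Letters.perc d p).pdbc x ≤ ENNReal.ofReal (1 + B) := by
  classical
  obtain ⟨hsum, hle⟩ := hB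
  have hB0 : 0 ≤ B := (tsum_nonneg fun x => diagD_nonneg p 1 1 x).trans hle
  calc ∑' x, (Letters.perc d p).pdbc x
      ≤ ∑' x, ((if x = 0 then (1 : ℝ≥0∞) else 0) + ENNReal.ofReal (diagD d p 1 1 x)) :=
        ENNReal.tsum_le_tsum fun x => perc_pdbc_le_kd_add p x
    _ = 1 + ENNReal.ofReal (∑' x, diagD d p 1 1 x) := by
        rw [ENNReal.tsum_add, tsum_ite_eq (0 : Site d) (fun _ => (1 : ℝ≥0∞)),
          ENNReal.ofReal_tsum_of_nonneg (fun x => diagD_nonneg p 1 1 x) hsum]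
    _ ≤ 1 + ENNReal.ofReal B := by gcongr
    _ = ENNReal.ofReal (1 + B) := by
        rw [ENNReal.ofReal_add zero_le_one hB0, ENNReal.ofReal_one]

/-- **ENTRY INEQUALITY `(V).0`: `(P⃗^E)_0 ≤ 1 + ½·Bound[Bubble, 2, M]`** at the percolation letters, in the
`ENNReal.ofReal` shape consumed by `BlockSummationMajorant.tsum_toReal_le_of_xSpaceBound_of_majorants` (`hPE`):
`d ≥ 5`, `p < p_c`, `(2d−1)p ≤ Γ₁`, `f₂(p) ≤ Γ₂`, `2 ≤ M`.
[cite: FitznerVanDerHofstad2017, §5.1 "Elements of the bounds" and App. B Table "P^b" row b = 0 (arXiv:1506.07977v2 pp. 49, 73); §5.4 closing paragraph (p. 56); §4.2 (4.20)–(4.21) (pp. 36–37)]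
[cite: FitznerVanDerHofstad2016NoBLE, §5.3.1 and (5.13) (PTRF 169 (2017) pp. 1091, 1096–1097)] -/
theorem vecPE_zero_le_ofReal (hd : 5 ≤ d) (p : unitInterval) (hp : p < criticalProbI d) {Γ₁ Γ₂ : ℝ}
    (hΓ1 : (2 * d - 1) * (p : ℝ) ≤ Γ₁) (hΓ2 : nobleF2 d p ≤ Γ₂) {M : ℕ} (hM : 2 ≤ M) :
    vecPE (Letters.perc d p) 0 ≤ ENNReal.ofReal (vecPEZeroR d p Γ₁ Γ₂ M) := by
  rw [vecPE_zero_eq, vecPEZeroR]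
  exact tsum_perc_pdbc_le_of_sumLE p
    (sumLE_diagD_halfBubblePrintedR hd p hp (n := 1) le_rfl (by simpa using hM) hΓ1 hΓ2)

/-- `0 ≤ vecPEZeroR` under the cell's hypotheses (the consumer's `hw0`/`hu0`).
[cite: FitznerVanDerHofstad2017, §5.1 "Elements of the bounds" (arXiv:1506.07977v2 p. 49)] -/
theorem vecPEZeroR_nonneg (hd : 5 ≤ d) (p : unitInterval) (hp : p < criticalProbI d) {Γ₁ Γ₂ : ℝ}
    (hΓ1 : (2 * d - 1) * (p : ℝ) ≤ Γ₁) (hΓ2 : nobleF2 d p ≤ Γ₂) {M : ℕ} (hM : 2 ≤ M) :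
    0 ≤ vecPEZeroR d p Γ₁ Γ₂ M :=
  add_nonneg zero_le_one (halfBubblePrintedR_nonneg hd p hp (n := 1) le_rfl (by simpa using hM) hΓ1 hΓ2)

/-- The same entry for the starting vector: `(P⃗^S)_0 = (P⃗^E)_0 ≤ 1 + ½·Bound[Bubble, 2, M]` (`vecPE_zero`), the
`hPS` hypothesis of the block-summation majorant at `a = 0`.
[cite: FitznerVanDerHofstad2017, §5.1 "Elements of the bounds" and App. B Table "P^b" row b = 0 (arXiv:1506.07977v2 pp. 49, 73); §4.2 (4.20)–(4.21) (pp. 36–37)] -/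
theorem vecPS_zero_le_ofReal (hd : 5 ≤ d) (p : unitInterval) (hp : p < criticalProbI d) {Γ₁ Γ₂ : ℝ}
    (hΓ1 : (2 * d - 1) * (p : ℝ) ≤ Γ₁) (hΓ2 : nobleF2 d p ≤ Γ₂) {M : ℕ} (hM : 2 ≤ M) :
    vecPS (Letters.perc d p) 0 ≤ ENNReal.ofReal (vecPEZeroR d p Γ₁ Γ₂ M) :=
  vecPE_zero (L := Letters.perc d p) ▸ vecPE_zero_le_ofReal hd p hp hΓ1 hΓ2 hM

/-! ## C. The element `(A)_{0,0} = Σ_{x ≠ 0} P̃_p(0 ⇔ x)` at the percolation letters -/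

/-- Pointwise majorant of the off-origin summand: `(1 − δ_{x,0}) P̃_p(0 ⇔ x) ≤ ofReal 𝓓_{1,1}(x)` (equality for
`x ≠ 0`; `0` at `x = 0`).
[cite: FitznerVanDerHofstad2017, App. B Table "definition of A^{a,b}(0,v,x,y)" row (0,0) (arXiv:1506.07977v2 p. 74); §4.2 (4.12) (p. 35)] -/
theorem kdc_mul_perc_pdbc_le (p : unitInterval) (x : Site d) :
    kdc x 0 * (Letters.perc d p).pdbc x ≤ ENNReal.ofReal (diagD d p 1 1 x) := by
  by_cases hx : x = 0
  · subst hx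
    rw [kdc_self, zero_mul]
    exact zero_le
  · rw [kdc_of_ne hx, one_mul, perc_pdbc_of_ne_zero p hx, diagD, ENNReal.ofReal_toReal (diagDT_ne_top p 1 1 x)]

/-- TRANSFER FORM: any genuine bound `Σ_x 𝓓_{1,1}(x) ≤ B` gives `(A)_{0,0} = Σ_{x ≠ 0} P̃_p(0 ⇔ x) ≤ ofReal B`
(`matA_zero_zero`).
[cite: FitznerVanDerHofstad2017, §5.1 (5.4) and "Elements of the bounds" (arXiv:1506.07977v2 pp. 48–49); App. B Table "definition of A^{a,b}(0,v,x,y)" row (0,0) (p. 74); §4.2 (4.20)–(4.21) (pp. 36–37)] -/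
theorem perc_matA_zero_zero_le_of_sumLE (p : unitInterval) {B : ℝ} (hB : SumLE (diagD d p 1 1) B) :
    matA (Letters.perc d p) 0 0 ≤ ENNReal.ofReal B := by
  obtain ⟨hsum, hle⟩ := hB
  rw [matA_zero_zero]
  calc ∑' x, kdc x 0 * (Letters.perc d p).pdbc x
      ≤ ∑' x, ENNReal.ofReal (diagD d p 1 1 x) := ENNReal.tsum_le_tsum fun x => kdc_mul_perc_pdbc_le p x
    _ = ENNReal.ofReal (∑' x, diagD d p 1 1 x) :=
        (ENNReal.ofReal_tsum_of_nonneg (fun x => diagD_nonneg p 1 1 x) hsum).symm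
    _ ≤ ENNReal.ofReal B := ENNReal.ofReal_le_ofReal hle

/-- **ENTRY INEQUALITY `(A)_{0,0} ≤ ½·Bound[Bubble, 2, M]`** at the percolation letters (`d ≥ 5`, `p < p_c`,
`(2d−1)p ≤ Γ₁`, `f₂(p) ≤ Γ₂`, `2 ≤ M`): the real majorant of the scalar `Σ_{z ≠ 0} P̃_p(0 ⇔ z)` in the
`ENNReal.ofReal` shape; its non-negativity is `halfBubblePrintedR_nonneg`.
[cite: FitznerVanDerHofstad2017, §5.1 (5.4) and "Elements of the bounds" (arXiv:1506.07977v2 pp. 48–49); App. B Table "definition of A^{a,b}(0,v,x,y)" row (0,0) (p. 74); §4.2 (4.20)–(4.21) (pp. 36–37)]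
[cite: FitznerVanDerHofstad2016NoBLE, §5.3.1 and (5.13) (PTRF 169 (2017) pp. 1091, 1096–1097)] -/
theorem perc_matA_zero_zero_le_ofReal (hd : 5 ≤ d) (p : unitInterval) (hp : p < criticalProbI d) {Γ₁ Γ₂ : ℝ}
    (hΓ1 : (2 * d - 1) * (p : ℝ) ≤ Γ₁) (hΓ2 : nobleF2 d p ≤ Γ₂) {M : ℕ} (hM : 2 ≤ M) :
    matA (Letters.perc d p) 0 0 ≤ ENNReal.ofReal (halfBubblePrintedR d p Γ₁ Γ₂ 1 M) :=
  perc_matA_zero_zero_le_of_sumLE p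
    (sumLE_diagD_halfBubblePrintedR hd p hp (n := 1) le_rfl (by simpa using hM) hΓ1 hΓ2)

end Literature.Probability.FitznerVanDerHofstad2017

end
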